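import Summits.QuantumFields.YangMills.Theorems.FluctuationComparisonRegPrIntLOrganTangentPullbackRowMass
import Summits.QuantumFields.YangMills.Theorems.FluctuationComparisonRegPrIntLRunpairOrganFibreLawDefs
import HarnessLib

/-!
# Crux `FluctuationComparisonRegPrIntL` (stmt-QuantumFields-20520, rung R3), PATH-B organ, JENSEN SIDE — DISCHARGE SPEC v1.0 §6 step 4, D4 TRANSPORT SIDE:
# **«COV-SANDWICH»** — the (JV1-h)∕(JV2-h) brackets of the frozen row `SpreadFibreLawHJ` (✓`…RunpairOrganFibreLawJDefs`, body ws16 3bd44078) from a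
# Brascamp–Lieb∕Helffer–Sjöstrand-SHAPED covariance-kernel hypothesis and transport-profile letters (instr-1 FL-29's `K·C_f·K` shape), DEFINITION-FREE

Cell `ym3-torus` (rung R3 = continuum `SU(2)` Yang–Mills on T³ — NOT d = 4, NOT infinite volume, NOT a mass gap, NOT Clay), width copy `ym3-torus-px5` (gen 20;
LEAD w3 g26 census v5.0 §6 (b) ∕ №22 «(JV1-h)∕(JV2-h) transport-side … open for a namer»; px5 g20 OFFER 07:29Z, SHAPE 07:45Z).
`--kind proof --supports stmt-QuantumFields-20520 --as helper`, count-neutral, DEF-FREE, default heartbeats, `autoImplicit false`; no registry ∕ binder ∕ `Lines/` edit.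

WHAT.  One abstract fibre `(Z, τ)`, coarse fields `GaugeField P j SU(2)` (one-bond moves `U ↦ U·expPt m @ B`, window `PlaqSmall θc`, sizes `‖m‖∕θc`), an abstract
corner-value family `Fobs : GaugeField P j SU(2) → Z → ℝ` (in the discharge: `X ↦ h_Ts∘Φ(X,·)`), an abstract law family `Law : ℝ → GaugeField P j SU(2) → Z → ℝ`
(`(t, Xw) ↦ ŵ_t(Xw,·) = wgt … t Xw`), a fine index type `ι` (the discharge takes PLAQUETTES of the fine torus — D-1's lesson, px19 LOCATE a69adec5 §3), and THREE
HYPOTHESIS LETTERS, none of which is proved here: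
* (P) a PROFILE PREDICATE `Prof : (Z → ℝ) → (ι → ℝ) → Prop` — «this observable has this fine profile»; ABSTRACT (the chart's `Z` is abstract in the row; the discharger
  defines `Prof` through the push-forward∕transport structure of ITS chart and proves (G)(K•); this file never looks inside);
* (G) «COV-KERNEL», t-UNIFORM (px5 (F1)): a kernel `𝒢 ≥ 0` on `ι × ι` with weighted row mass `≤ NG` such that for every `t ∈ [0,1]`, every window law point `Xw` and
  every two profiled observables, the `ŵ_t(Xw)`-COVARIANCE (both sides centred at their own `ŵ_t(Xw)`-means, `Integrable` as a CONJUNCT) is bounded by the sandwich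
  `Σ_{a,c} |p a|·𝒢 a c·|q c|` — the Brascamp–Lieb ∕ Helffer–Sjöstrand SHAPE (tree model: ✓`Literature.Probability.….BrascampLieb1976_thm41_holds`; print: the
  propagator decay of [Balaban1984PropagatorsII] ∕ [Balaban1985UV3] for `𝒢`, [Balaban1988RG2Cluster] Lemma 3 for the non-Gaussian remainder) = the covariance
  part of the spec's «FIBRE-LAW CLUSTER BOUNDS» row;
* (K1)∕(K2)∕(K0) TRANSPORT PROFILES: a first-order letter `K : ι → PBond → ℝ` (column∕row masses `Ncol`, `Nrow`) profiling every admissible one-bond difference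
  `F_{V₁} − F_{U₁}` by `(‖m‖∕θc)·K(·,B)`; a second-order letter `K2 : ι → PBond → PBond → ℝ` (mass `NY`) profiling the square's `ΔΔF` by `sz·sz′·K2(·,B,B′)`; and the
  FLAT profile `x₀` of every corner value `F_X` (a GLOBAL functional: no decay, only size) — the response part of the spec's «MINIMISER CHART» row
  ([Balaban1985Variational] Thm 1 (9)–(10), Prop 9 (190); px19 g20's `KP`∕`KP2` dictionary).
CONCLUSIONS (the (JV•) clause SHAPES of [12b] with `Fobs`, `Law`, `θc`, the coarse weight `exp(κ·tdist)` and an abstract row-mass budget `M`; a consumer instantiates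
`Fobs := fun X z => log ρ_Ts (Φ (X,z)) − log ρ′_Ts (Φ (X,z))`, `Law := fun t Xw z => wgt … t Xw z`, `θc := θBal_j∕4`, `M := NV•·Dr·w·(w∕D_Ts) + δV• j·D_j` and closes the
frozen conjunct by `exact` — δ∕β-unfolding only):
* §1 ★★`jv2Clause_of_covKernel_profiles` — (P)(G)(K1) + `Ncol·NG·Nrow ≤ M` ⟹ the (JV2-h) clause with `kV₂ B B′ := Σ_{a,c} K a B·𝒢 a c·K c B′`
  (row mass = ✓`OrganTangentPullbackRowMass.rowMass_sandwich_le`, ZERO new algebra);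
* §2 ★★`jv1Clause_of_covKernel_profiles` — (P)(G)(K2)(K0) + the (JV0-h) law facts (`∫ ŵ = 1`, `Integrable ŵ`, `Integrable (F_X·ŵ)` — ✓`wgt_normalised` ∕ the row)
  + `x₀·NG₀·NY ≤ M` ⟹ the (JV1-h) clause with `kV₁ B B′ := x₀·Σ_a (Σ_c 𝒢 a c)·K2 a B B′` (row mass = ✓`rowMass_gradient_le`); the un-centred left factor `ΔΔF` of
  (JV1-h) is re-centred for free (`∫ (F_X − c)·ŵ = 0`).
BUDGET READING (docstring, not smuggled): the profiles of differences of the O(x) functional `h_Ts` carry one `x` each and `x₀ ~ x`, so `Ncol·NG·Nrow`, `x₀·NG₀·NY`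
are O(x²) — the QUADRATIC masses of (HV′) (R5).  VOLUME (LEAD №23 (iv)): (JV1-h)'s bound `sz·sz′·x₀·Σ_a K2(a,B,B′)·(Σ_c 𝒢 a c)` is volume-free although `F_X`'s
profile is flat — the only sum over the fine index runs through `K2(·,B,B′)`, which is LOCALISED near `{B, B′}` (its κ-mass `NY` is the letter); no `#ι` appears.
ORDER OF THE LETTERS AT DISCHARGE (w4 g23 07:46Z, SPEC v1.3): (K1) is a second mixed derivative of `h_Ts∘Φ` (datum × fibre), (K2) a THIRD one (datum × datum × fibre)
— so the «CURVATURE LETTERS OF `h_Ts`» input row is read at orders 1–3 (one Cauchy estimate on the same polydisc in the polymer form of [Balaban1987RG1] (0.22));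
instr-1's free-toy `NV1 = 0` is the Gaussian degeneracy (`ΔΔF` is `z`-constant there), not evidence about the order.  Here `Prof` is abstract, so nothing changes.

HONEST FRAMING: bookkeeping over HYPOTHESIS letters ([folklore] algebra); (P)(G)(K0)(K1)(K2) are exactly as OPEN as (JV1-h)(JV2-h) — this file only factors them into the
two print-shaped rows of the spec's §6 step 5; nothing of Bałaban's analysis is asserted or proved; `SpreadFibreLawH(J)` remain hypothesis rows; JVAR″, JEN″, LIN″,
O1ᵘ-H v2.2, S1aᴴ, S3ᴴ, S2β, the five registered stubs, crux 20520 and `YM3TorusSU2` are NOT proved; registry `Lines/semiclassical_s2beta.lean` and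
`Lines/runpair_organ.lean` untouched, nothing here is registered; rung R3 = SU(2) YM₃ on T³ — NOT d = 4, NOT infinite volume, NOT a mass gap, NOT Clay; the Yang–Mills
mass gap is NOT proved by any of this.  Credit: LEAD w3 g26 (spec, R1–R5), px19 g20 (curvature-indexed letters), instr-1 g14 (FL-29 shape), w5 (RM-PB lineage).
-/

set_option autoImplicit false

noncomputable section

namespace Summit.QuantumFields.YangMills.Theorems.OrganTangentCovSandwich

open MeasureTheory
open scoped BigOperators
open Literature.MathematicalPhysics.QuantumFieldTheory.Balaban1983to89 T3ContinuumYM3Torus T3NestedUnitLaws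
  T3UnitLawDensityEML T4Continuum BalabanUVClass T3UnitScaleTilt T3LevelShift T3TiltDescent
open T4CubeChartExp (expPt)
open Summit.QuantumFields.YangMills.Theorems.OrganTangentPullbackRowMass (rowMass_sandwich_le rowMass_gradient_le)

variable {P : Params} {j : ℕ} {ι : Type*} [Fintype ι] {Z : Type*} [MeasurableSpace Z]

/-! ## §0 Small algebra -/

/-- kernel: pulling the two move sizes out of the sandwich `Σ_{a,c} |s·K a B|·𝒢 a c·|s′·K c B′|` (nonnegative letters and sizes). [folklore] -/
theorem sandwich_abs_sizes_eq (K : ι → PBond P j → ℝ) (𝒢 : ι → ι → ℝ) (hK : ∀ a B, 0 ≤ K a B)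
    (B B' : PBond P j) {s s' : ℝ} (hs : 0 ≤ s) (hs' : 0 ≤ s') :
    ∑ a, ∑ c, |s * K a B| * 𝒢 a c * |s' * K c B'| = (∑ a, ∑ c, K a B * 𝒢 a c * K c B') * s * s' := by
  rw [Finset.sum_mul, Finset.sum_mul]
  refine Finset.sum_congr rfl fun a _ => ?_
  rw [Finset.sum_mul, Finset.sum_mul]
  refine Finset.sum_congr rfl fun c _ => ?_
  rw [abs_of_nonneg (mul_nonneg hs (hK a B)), abs_of_nonneg (mul_nonneg hs' (hK c B'))]
  ring

/-- kernel: pulling the sizes and the flat profile out of `Σ_{a,c} |s·s′·K2 a|·𝒢 a c·|x₀|`. [folklore] -/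
theorem gradient_abs_sizes_eq (K2 : ι → ℝ) (𝒢 : ι → ι → ℝ) (hK2 : ∀ a, 0 ≤ K2 a) {s s' x₀ : ℝ} (hs : 0 ≤ s) (hs' : 0 ≤ s') (hx₀ : 0 ≤ x₀) :
    ∑ a, ∑ c, |s * s' * K2 a| * 𝒢 a c * |x₀| = (x₀ * ∑ a, (∑ c, 𝒢 a c) * K2 a) * s * s' := by
  rw [Finset.mul_sum, Finset.sum_mul, Finset.sum_mul]
  refine Finset.sum_congr rfl fun a _ => ?_
  rw [Finset.sum_mul, Finset.mul_sum, Finset.sum_mul, Finset.sum_mul]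
  refine Finset.sum_congr rfl fun c _ => ?_
  rw [abs_of_nonneg (mul_nonneg (mul_nonneg hs hs') (hK2 a)), abs_of_nonneg hx₀]
  ring

/-- kernel: an un-centred left factor against a NORMALISED law with the right factor centred at its own mean equals the covariance. [folklore] -/
theorem integral_mul_centred_eq_cov (τ : Measure Z) (A Bf w : Z → ℝ) (cA cB : ℝ)
    (hw : Integrable w τ) (hn : ∫ z, w z ∂τ = 1) (hB : Integrable (fun z => Bf z * w z) τ) (hcB : cB = ∫ z, Bf z * w z ∂τ)
    (hcov : Integrable (fun z => (A z - cA) * (Bf z - cB) * w z) τ) :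
    Integrable (fun z => A z * (Bf z - cB) * w z) τ ∧
      ∫ z, A z * (Bf z - cB) * w z ∂τ = ∫ z, (A z - cA) * (Bf z - cB) * w z ∂τ := by
  have hcen : Integrable (fun z => (Bf z - cB) * w z) τ := by
    have h : Integrable (fun z => Bf z * w z - cB * w z) τ := hB.sub (hw.const_mul cB)
    exact h.congr (Filter.Eventually.of_forall fun z => by beta_reduce; ring)
  have hzero : ∫ z, (Bf z - cB) * w z ∂τ = 0 := by
    have e : (fun z => (Bf z - cB) * w z) = fun z => Bf z * w z - cB * w z := by funext z; ring
    rw [e, integral_sub hB (hw.const_mul cB), integral_const_mul, hn, mul_one, hcB, sub_self]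
  have hsum : Integrable (fun z => (A z - cA) * (Bf z - cB) * w z + cA * ((Bf z - cB) * w z)) τ := hcov.add (hcen.const_mul cA)
  have e : (fun z => A z * (Bf z - cB) * w z) = fun z => (A z - cA) * (Bf z - cB) * w z + cA * ((Bf z - cB) * w z) := by
    funext z; ring
  refine ⟨by rw [e]; exact hsum, ?_⟩
  rw [e, integral_add hcov (hcen.const_mul cA), integral_const_mul, hzero, mul_zero, add_zero]

/-! ## §1 (JV2-h) from the covariance kernel and the first-order transport profile -/

/-- ★★ **(JV2-h) ⟸ COV-KERNEL × TRANSPORT PROFILES** (the clause SHAPE of `SpreadFibreLawHJ`'s (JV2-h) conjunct, abstract corner values `Fobs`, laws `Law`, window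
`θc`, sizes `‖m‖∕θc`; see the module docstring for the three hypothesis letters and the instantiation).  `kV₂ B B′ := Σ_{a,c} K a B·𝒢 a c·K c B′`; its κ-row mass is
✓`rowMass_sandwich_le` (`≤ Ncol·NG·Nrow ≤ M`). [folklore] -/
theorem jv2Clause_of_covKernel_profiles (τ : Measure Z) (Fobs : GaugeField P j ↥(Matrix.specialUnitaryGroup (Fin 2) ℂ) → Z → ℝ)
    (Law : ℝ → GaugeField P j ↥(Matrix.specialUnitaryGroup (Fin 2) ℂ) → Z → ℝ) (θc rc κ M : ℝ) (hθc : 0 < θc)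
    (Prof : (Z → ℝ) → (ι → ℝ) → Prop)
    -- (G) the covariance kernel, t-uniform
    (𝒢 : ι → ι → ℝ) (ωf : ι → ι → ℝ) (NG : ℝ) (hG0 : ∀ a c, 0 ≤ 𝒢 a c) (hωf : ∀ a c, 0 ≤ ωf a c) (hNG : 0 ≤ NG)
    (hGrow : ∀ a, ∑ c, 𝒢 a c * ωf a c ≤ NG)
    (hCov : ∀ t : ℝ, 0 ≤ t → t ≤ 1 → ∀ Xw : GaugeField P j ↥(Matrix.specialUnitaryGroup (Fin 2) ℂ), PlaqSmall θc Xw →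
      ∀ (Pf Qf : Z → ℝ) (p q : ι → ℝ), Prof Pf p → Prof Qf q → ∀ (cP cQ : ℝ),
        cP = ∫ z, Pf z * Law t Xw z ∂τ → cQ = ∫ z, Qf z * Law t Xw z ∂τ →
          Integrable (fun z => (Pf z - cP) * (Qf z - cQ) * Law t Xw z) τ ∧
            |∫ z, (Pf z - cP) * (Qf z - cQ) * Law t Xw z ∂τ| ≤ ∑ a, ∑ c, |p a| * 𝒢 a c * |q c|)
    -- (K1) the first-order transport profile
    (K : ι → PBond P j → ℝ) (ωX : ι → PBond P j → ℝ) (Ncol Nrow : ℝ) (hK0 : ∀ a B, 0 ≤ K a B) (hωX : ∀ a B, 0 ≤ ωX a B)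
    (hNrow : 0 ≤ Nrow) (hKcol : ∀ B, ∑ a, K a B * ωX a B ≤ Ncol) (hKrow : ∀ c, ∑ B', K c B' * ωX c B' ≤ Nrow)
    (htri : ∀ (B B' : PBond P j) (a c : ι), Real.exp (κ * (B.src.tdist B'.src : ℝ)) ≤ ωX a B * ωf a c * ωX c B')
    (hProf1 : ∀ (B : PBond P j) (m : Fin 3 → ℝ) (U₁ V₁ : GaugeField P j ↥(Matrix.specialUnitaryGroup (Fin 2) ℂ)),
      ‖m‖ ≤ rc * θc → PlaqSmall θc U₁ → PlaqSmall θc V₁ → (∀ e, e ≠ B → V₁ e = U₁ e) → V₁ B = U₁ B * expPt m →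
        Prof (fun z => Fobs V₁ z - Fobs U₁ z) (fun a => ‖m‖ / θc * K a B))
    (hM : Ncol * NG * Nrow ≤ M) :
    ∃ kV₂ : PBond P j → PBond P j → ℝ, (∀ B B', 0 ≤ kV₂ B B') ∧
      (∀ B, ∑ B', kV₂ B B' * Real.exp (κ * (B.src.tdist B'.src : ℝ)) ≤ M) ∧
      ∀ t : ℝ, 0 ≤ t → t ≤ 1 → (∀ (B B' : PBond P j) (m m' : Fin 3 → ℝ)
        (U V W Y Xw : GaugeField P j ↥(Matrix.specialUnitaryGroup (Fin 2) ℂ)),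
        ‖m‖ ≤ rc * θc → ‖m'‖ ≤ rc * θc → PlaqSmall θc U → PlaqSmall θc V → PlaqSmall θc W → PlaqSmall θc Y → PlaqSmall θc Xw →
        (∀ e, e ≠ B → V e = U e) → V B = U B * expPt m → (∀ e, e ≠ B' → W e = U e) → W B' = U B' * expPt m' →
        (∀ e, e ≠ B' → Y e = V e) → Y B' = V B' * expPt m' →
        ∀ (c₁ c₂ : ℝ), c₁ = ∫ z, (Fobs V z - Fobs U z) * Law t Xw z ∂τ → c₂ = ∫ z, (Fobs W z - Fobs U z) * Law t Xw z ∂τ →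
          Integrable (fun z => ((Fobs V z - Fobs U z) - c₁) * ((Fobs W z - Fobs U z) - c₂) * Law t Xw z) τ ∧
          |∫ z, ((Fobs V z - Fobs U z) - c₁) * ((Fobs W z - Fobs U z) - c₂) * Law t Xw z ∂τ|
            ≤ kV₂ B B' * (‖m‖ / θc) * (‖m'‖ / θc)) := by
  refine ⟨fun B B' => ∑ a, ∑ c, K a B * 𝒢 a c * K c B', fun B B' => ?_, fun B => ?_, ?_⟩
  · exact Finset.sum_nonneg fun a _ => Finset.sum_nonneg fun c _ => mul_nonneg (mul_nonneg (hK0 a B) (hG0 a c)) (hK0 c B')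
  · exact (rowMass_sandwich_le 𝒢 K ωf (fun B B' => Real.exp (κ * (B.src.tdist B'.src : ℝ))) ωX hG0 hK0 hωf hωX htri hNG hNrow
      hKcol hKrow hGrow B).trans hM
  · intro t ht0 ht1 B B' m m' U V W Y Xw hm hm' hU hV hW _hY hXw hVU hVB hWU hWB _hYV _hYB c₁ c₂ hc₁ hc₂
    have hp := hProf1 B m U V hm hU hV hVU hVB
    have hq := hProf1 B' m' U W hm' hU hW hWU hWB
    obtain ⟨hint, hbd⟩ := hCov t ht0 ht1 Xw hXw _ _ _ _ hp hq c₁ c₂ hc₁ hc₂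
    refine ⟨hint, hbd.trans (le_of_eq ?_)⟩
    exact sandwich_abs_sizes_eq K 𝒢 hK0 B B' (div_nonneg (norm_nonneg _) hθc.le) (div_nonneg (norm_nonneg _) hθc.le)

/-! ## §2 (JV1-h) from the covariance kernel, the second-order transport profile and the flat corner profile -/

/-- ★★ **(JV1-h) ⟸ COV-KERNEL × TRANSPORT PROFILES** (the clause SHAPE of `SpreadFibreLawHJ`'s (JV1-h) conjunct).  The un-centred left factor `ΔΔF` is re-centred
for free against the normalised law ((JV0-h) facts `hLawN`, `hLawF`); `kV₁ B B′ := x₀·Σ_a (Σ_c 𝒢 a c)·K2 a B B′`, row mass by ✓`rowMass_gradient_le`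
(`≤ (x₀·NG₀)·NY ≤ M`). [folklore] -/
theorem jv1Clause_of_covKernel_profiles (τ : Measure Z) (Fobs : GaugeField P j ↥(Matrix.specialUnitaryGroup (Fin 2) ℂ) → Z → ℝ)
    (Law : ℝ → GaugeField P j ↥(Matrix.specialUnitaryGroup (Fin 2) ℂ) → Z → ℝ) (θc rc κ M : ℝ) (hθc : 0 < θc)
    (Prof : (Z → ℝ) → (ι → ℝ) → Prop)
    -- (JV0-h) law facts used for the re-centring
    (hLawN : ∀ t : ℝ, 0 ≤ t → t ≤ 1 → ∀ Xw : GaugeField P j ↥(Matrix.specialUnitaryGroup (Fin 2) ℂ), PlaqSmall θc Xw →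
      Integrable (fun z => Law t Xw z) τ ∧ ∫ z, Law t Xw z ∂τ = 1)
    (hLawF : ∀ t : ℝ, 0 ≤ t → t ≤ 1 → ∀ X Xw : GaugeField P j ↥(Matrix.specialUnitaryGroup (Fin 2) ℂ), PlaqSmall θc X → PlaqSmall θc Xw →
      Integrable (fun z => Fobs X z * Law t Xw z) τ)
    -- (G) the covariance kernel, t-uniform (unweighted row mass `NG₀` is what (JV1-h) needs)
    (𝒢 : ι → ι → ℝ) (NG₀ : ℝ) (hG0 : ∀ a c, 0 ≤ 𝒢 a c) (hNG₀ : 0 ≤ NG₀) (hGrow₀ : ∀ a, ∑ c, 𝒢 a c ≤ NG₀)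
    (hCov : ∀ t : ℝ, 0 ≤ t → t ≤ 1 → ∀ Xw : GaugeField P j ↥(Matrix.specialUnitaryGroup (Fin 2) ℂ), PlaqSmall θc Xw →
      ∀ (Pf Qf : Z → ℝ) (p q : ι → ℝ), Prof Pf p → Prof Qf q → ∀ (cP cQ : ℝ),
        cP = ∫ z, Pf z * Law t Xw z ∂τ → cQ = ∫ z, Qf z * Law t Xw z ∂τ →
          Integrable (fun z => (Pf z - cP) * (Qf z - cQ) * Law t Xw z) τ ∧
            |∫ z, (Pf z - cP) * (Qf z - cQ) * Law t Xw z ∂τ| ≤ ∑ a, ∑ c, |p a| * 𝒢 a c * |q c|)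
    -- (K2) the second-order transport profile of the square's `ΔΔF`
    (K2 : ι → PBond P j → PBond P j → ℝ) (NY : ℝ) (hK20 : ∀ a B B', 0 ≤ K2 a B B')
    (hK2mass : ∀ B, ∑ a, ∑ B', K2 a B B' * Real.exp (κ * (B.src.tdist B'.src : ℝ)) ≤ NY)
    (hProf2 : ∀ (B B' : PBond P j) (m m' : Fin 3 → ℝ) (U V W Y : GaugeField P j ↥(Matrix.specialUnitaryGroup (Fin 2) ℂ)),
      ‖m‖ ≤ rc * θc → ‖m'‖ ≤ rc * θc → PlaqSmall θc U → PlaqSmall θc V → PlaqSmall θc W → PlaqSmall θc Y →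
      (∀ e, e ≠ B → V e = U e) → V B = U B * expPt m → (∀ e, e ≠ B' → W e = U e) → W B' = U B' * expPt m' →
      (∀ e, e ≠ B' → Y e = V e) → Y B' = V B' * expPt m' →
        Prof (fun z => Fobs Y z - Fobs V z - Fobs W z + Fobs U z) (fun a => ‖m‖ / θc * (‖m'‖ / θc) * K2 a B B'))
    -- (K0) the flat profile of every corner value
    (x₀ : ℝ) (hx₀ : 0 ≤ x₀)
    (hProf0 : ∀ X : GaugeField P j ↥(Matrix.specialUnitaryGroup (Fin 2) ℂ), PlaqSmall θc X → Prof (fun z => Fobs X z) (fun _ => x₀))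
    (hM : x₀ * NG₀ * NY ≤ M) :
    ∃ kV₁ : PBond P j → PBond P j → ℝ, (∀ B B', 0 ≤ kV₁ B B') ∧
      (∀ B, ∑ B', kV₁ B B' * Real.exp (κ * (B.src.tdist B'.src : ℝ)) ≤ M) ∧
      ∀ t : ℝ, 0 ≤ t → t ≤ 1 → (∀ (B B' : PBond P j) (m m' : Fin 3 → ℝ)
        (U V W Y X Xw : GaugeField P j ↥(Matrix.specialUnitaryGroup (Fin 2) ℂ)),
        ‖m‖ ≤ rc * θc → ‖m'‖ ≤ rc * θc → PlaqSmall θc U → PlaqSmall θc V → PlaqSmall θc W → PlaqSmall θc Y →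
        PlaqSmall θc X → PlaqSmall θc Xw →
        (∀ e, e ≠ B → V e = U e) → V B = U B * expPt m → (∀ e, e ≠ B' → W e = U e) → W B' = U B' * expPt m' →
        (∀ e, e ≠ B' → Y e = V e) → Y B' = V B' * expPt m' →
        ∀ (c : ℝ), c = ∫ z, Fobs X z * Law t Xw z ∂τ →
          Integrable (fun z => (Fobs Y z - Fobs V z - Fobs W z + Fobs U z) * (Fobs X z - c) * Law t Xw z) τ ∧
          |∫ z, (Fobs Y z - Fobs V z - Fobs W z + Fobs U z) * (Fobs X z - c) * Law t Xw z ∂τ|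
            ≤ kV₁ B B' * (‖m‖ / θc) * (‖m'‖ / θc)) := by
  refine ⟨fun B B' => x₀ * ∑ a, (∑ c, 𝒢 a c) * K2 a B B', fun B B' => ?_, fun B => ?_, ?_⟩
  · exact mul_nonneg hx₀ (Finset.sum_nonneg fun a _ => mul_nonneg (Finset.sum_nonneg fun c _ => hG0 a c) (hK20 a B B'))
  · -- row mass: ✓`rowMass_gradient_le` with `g a := x₀·Σ_c 𝒢 a c ≤ x₀·NG₀`
    have h := rowMass_gradient_le (fun a => x₀ * ∑ c, 𝒢 a c) K2 (fun B B' => Real.exp (κ * (B.src.tdist B'.src : ℝ)))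
      hK20 (fun B B' => (Real.exp_pos _).le) (mul_nonneg hx₀ hNG₀) (fun a => mul_le_mul_of_nonneg_left (hGrow₀ a) hx₀) hK2mass B
    refine le_trans (le_of_eq (Finset.sum_congr rfl fun B' _ => ?_)) (h.trans hM)
    beta_reduce
    rw [Finset.mul_sum]
    congr 1
    exact Finset.sum_congr rfl fun a _ => by ring
  · intro t ht0 ht1 B B' m m' U V W Y X Xw hm hm' hU hV hW hY hX hXw hVU hVB hWU hWB hYV hYB c hc
    have hp := hProf2 B B' m m' U V W Y hm hm' hU hV hW hY hVU hVB hWU hWB hYV hYB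
    have hq := hProf0 X hX
    obtain ⟨hWi, hWn⟩ := hLawN t ht0 ht1 Xw hXw
    have hFX := hLawF t ht0 ht1 X Xw hX hXw
    obtain ⟨hint, hbd⟩ := hCov t ht0 ht1 Xw hXw (fun z => Fobs Y z - Fobs V z - Fobs W z + Fobs U z) (fun z => Fobs X z)
      (fun a => ‖m‖ / θc * (‖m'‖ / θc) * K2 a B B') (fun _ => x₀) hp hq
      (∫ z, (Fobs Y z - Fobs V z - Fobs W z + Fobs U z) * Law t Xw z ∂τ) c rfl hc
    obtain ⟨hint2, heq⟩ := integral_mul_centred_eq_cov τ (fun z => Fobs Y z - Fobs V z - Fobs W z + Fobs U z) (fun z => Fobs X z)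
      (Law t Xw) (∫ z, (Fobs Y z - Fobs V z - Fobs W z + Fobs U z) * Law t Xw z ∂τ) c hWi hWn hFX hc hint
    have heq' : ∫ z, (Fobs Y z - Fobs V z - Fobs W z + Fobs U z) * (Fobs X z - c) * Law t Xw z ∂τ
        = ∫ z, ((Fobs Y z - Fobs V z - Fobs W z + Fobs U z) - ∫ z, (Fobs Y z - Fobs V z - Fobs W z + Fobs U z) * Law t Xw z ∂τ)
            * (Fobs X z - c) * Law t Xw z ∂τ := heq
    refine ⟨hint2, ?_⟩
    rw [heq']
    refine hbd.trans (le_of_eq ?_)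
    exact gradient_abs_sizes_eq (fun a => K2 a B B') 𝒢 (fun a => hK20 a B B')
      (div_nonneg (norm_nonneg _) hθc.le) (div_nonneg (norm_nonneg _) hθc.le) hx₀

end Summit.QuantumFields.YangMills.Theorems.OrganTangentCovSandwich

end
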